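import Literature.Computability.AlgebraicComplexity.DeterminantalComplexity
import Literature.Computability.AlgebraicComplexity.LinSubst
import HarnessLib

/-!
# Equivariant determinantal complexity (Landsberg–Ressayre)

Topic: `Literature/Computability/AlgebraicComplexity`. Definition request
`defn-equivariantDetComplexity` (route `ValiantsHypothesis/DetQP`, item
stmt-ValiantsHypothesis-0319).

## Content

* `linStabilizer f : Subgroup (GL σ k)` — the stabiliser `G_f = {γ | γ · f = f}` of a polynomial
  under linear substitution of variables (`linSubstRep`, `LinSubst.lean`) (Landsberg–Ressayre 2017,
  §1: the symmetry group `G_P`).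
* `Matrix.linSubstEntries γ A` — the substituted matrix `A(γ · x)` (entrywise `linSubst γ`).
* `IsEquivariantDetRepr Γ f A` — `A` is an affine determinantal representation of `f`
  (`IsAffineDetRepr`, `DeterminantalComplexity.lean`) that **respects the symmetries `Γ`**: every
  `γ ∈ Γ` lifts to a pair `(g, h) ∈ GL_m × GL_m` with `A(γ · x) = g · A(x) · h⁻¹`
  (Landsberg–Ressayre 2017, Def. 1.3, in the concrete form requested: the lift is sought in the
  identity component `GL_m × GL_m` of `𝔾_{det_m}` acting by `X ↦ g X h⁻¹`).
* `HasEquivariantDetRepr Γ f m`, `equivariantDetComplexity Γ f = edc_Γ(f)` — the least size of a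
  `Γ`-equivariant affine determinantal representation (Landsberg–Ressayre 2017, §1, `edc`), an
  `sInf` over `ℕ` with junk value `0` if none exists.
* API: the trivial group imposes nothing (`isEquivariantDetRepr_bot_iff`,
  `equivariantDetComplexity_bot`), antitonicity in `Γ`, `dc ≤ edc_Γ` when an equivariant
  representation exists, and equivariance forces projective invariance of `f`
  (`IsEquivariantDetRepr.linSubst_eq_smul`: `γ · f = det g · det h⁻¹ · f`).

## Source

* J. M. Landsberg, N. Ressayre, *Permanent v. determinant: an exponential lower bound assuming
  symmetry and a potential path towards Valiant's conjecture*, Differential Geom. Appl. 55 (2017),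
  146–166 (arXiv:1508.05788): §1 (`G_P`, `𝔾_{det_n} ≅ (GL_n × GL_n)/ℂ* ⋊ ℤ₂`), Def. 1.3
  (representations respecting symmetry), `edc`; Thm. 2.1 (`edc(perm_m) = C(2m,m) - 1` for the left
  torus-and-permutation symmetry, `m ≥ 3`), Thm. 2.13.
* T. Mignon, N. Ressayre, *A quadratic bound for the determinant and permanent problem*, IMRN 2004,
  §1 (conventions for `dc`, as in `DeterminantalComplexity.lean`).

## Design choices and deviations (read before use)

* Landsberg–Ressayre's `𝔾_{det_n}` also contains transposition and acts projectively (`P(g⁻¹y) ∈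
  ℂ* P(y)`); following the request, lifts are taken in `GL_m × GL_m` acting by `g X h⁻¹` and the
  identity `A(γ·x) = g A(x) h⁻¹` is exact. This is the form used in LR17 §2 for the left symmetry
  group of the permanent (no transpose is needed there); a transpose-allowing variant would be a
  disjunction with `A(γ·x) = g A(x)ᵀ h⁻¹`.
* `Γ` is any subgroup of `GL σ k`; it is *not* required to lie in `G_f` — equivariance forces
  `γ · f = (det g / det h) f` anyway (`linSubst_eq_smul`), i.e. `Γ ⊆ 𝔾_f` (projective stabiliser).
* The concrete left-symmetry group `Γ^L = T^{GL_m} ⋊ 𝔖_m` of `perm_m` and the numerical facts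
  LR17 Thm. 2.1 / 2.13 are not vendored here (they need `Γ^L ⊆ GL(m²)` as a subgroup; separate
  cite item of the route).
-/

noncomputable section

open MvPolynomial Matrix

namespace Literature.Computability.AlgebraicComplexity

universe u v

variable {k : Type u} [CommRing k] {σ : Type v} [Fintype σ] [DecidableEq σ]

/-! ## Stabiliser and substituted matrices -/

/-- The stabiliser `G_f = {γ ∈ GL(σ) | γ · f = f}` of a polynomial under linear substitution of
variables (`linSubstRep`) (Landsberg–Ressayre 2017, §1, the group `G_P`).
[cite: LandsbergRessayre2017, §1 (G_P)] -/
def linStabilizer (f : MvPolynomial σ k) : Subgroup (GL σ k) where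
  carrier := {γ | linSubstRep σ k γ f = f}
  one_mem' := by simp [linSubst_one]
  mul_mem' {a b} ha hb := by
    simp only [Set.mem_setOf_eq] at ha hb ⊢
    rw [map_mul, Module.End.mul_apply, hb, ha]
  inv_mem' {a} ha := by
    simp only [Set.mem_setOf_eq] at ha ⊢
    conv_lhs => rw [← ha]
    rw [← Module.End.mul_apply, ← map_mul, inv_mul_cancel, map_one, Module.End.one_apply]

/-- Membership in the stabiliser. [cite: LandsbergRessayre2017, §1 (G_P)] -/
@[simp] theorem mem_linStabilizer {f : MvPolynomial σ k} {γ : GL σ k} :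
    γ ∈ linStabilizer f ↔ linSubstRep σ k γ f = f := Iff.rfl

/-- The matrix of affine forms `A(γ · x)`: apply the linear substitution `γ` to every entry of `A`
(Landsberg–Ressayre 2017, §1). [cite: LandsbergRessayre2017, §1] -/
def Matrix.linSubstEntries {m : Type*} (γ : GL σ k) (A : Matrix m m (MvPolynomial σ k)) :
    Matrix m m (MvPolynomial σ k) :=
  A.map (linSubst σ k (γ : Matrix σ σ k))

/-- The identity substitution does nothing to the entries. [folklore] -/
@[simp] theorem Matrix.linSubstEntries_one {m : Type*} (A : Matrix m m (MvPolynomial σ k)) :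
    Matrix.linSubstEntries (1 : GL σ k) A = A := by
  ext i j
  simp [Matrix.linSubstEntries, linSubst_one]

/-! ## Equivariant determinantal representations and `edc` -/

/-- `A` is a **`Γ`-equivariant affine determinantal representation** of `f` ("respects the
symmetries `Γ`"): `A` is an affine determinantal representation of `f` (entries of degree `≤ 1`,
`det A = f`) and every `γ ∈ Γ` lifts to `(g, h) ∈ GL_m × GL_m` with `A(γ · x) = g · A(x) · h⁻¹`
(Landsberg–Ressayre 2017, Def. 1.3; concrete `GL_m × GL_m` form, see the module docstring).
[cite: LandsbergRessayre2017, Def. 1.3] -/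
def IsEquivariantDetRepr (Γ : Subgroup (GL σ k)) (f : MvPolynomial σ k) {m : ℕ}
    (A : Matrix (Fin m) (Fin m) (MvPolynomial σ k)) : Prop :=
  IsAffineDetRepr f A ∧
    ∀ γ ∈ Γ, ∃ g h : GL (Fin m) k,
      Matrix.linSubstEntries γ A =
        (g : Matrix (Fin m) (Fin m) k).map C * A *
          ((h⁻¹ : GL (Fin m) k) : Matrix (Fin m) (Fin m) k).map C

/-- `f` has a `Γ`-equivariant affine determinantal representation of size `m`.
[cite: LandsbergRessayre2017, Def. 1.3] -/
def HasEquivariantDetRepr (Γ : Subgroup (GL σ k)) (f : MvPolynomial σ k) (m : ℕ) : Prop :=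
  ∃ A : Matrix (Fin m) (Fin m) (MvPolynomial σ k), IsEquivariantDetRepr Γ f A

/-- The **equivariant determinantal complexity** `edc_Γ(f)`: the least size of a `Γ`-equivariant
affine determinantal representation of `f` (Landsberg–Ressayre 2017, §1). An `sInf` over `ℕ`:
junk value `0` if `f` has no `Γ`-equivariant representation of any size.
[cite: LandsbergRessayre2017, §1 (edc)] -/
def equivariantDetComplexity (Γ : Subgroup (GL σ k)) (f : MvPolynomial σ k) : ℕ :=
  sInf {m : ℕ | HasEquivariantDetRepr Γ f m}

/-! ## API -/

variable {Γ Γ' : Subgroup (GL σ k)} {f : MvPolynomial σ k} {m : ℕ}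
  {A : Matrix (Fin m) (Fin m) (MvPolynomial σ k)}

/-- An equivariant representation is a representation. [cite: LandsbergRessayre2017, Def. 1.3] -/
theorem IsEquivariantDetRepr.isAffineDetRepr (h : IsEquivariantDetRepr Γ f A) :
    IsAffineDetRepr f A := h.1

/-- Equivariance is antitone in the symmetry group. [cite: LandsbergRessayre2017, Def. 1.3] -/
theorem IsEquivariantDetRepr.anti (h : IsEquivariantDetRepr Γ f A) (hle : Γ' ≤ Γ) :
    IsEquivariantDetRepr Γ' f A :=
  ⟨h.1, fun γ hγ => h.2 γ (hle hγ)⟩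

/-- For the trivial group, equivariance is no condition. [cite: LandsbergRessayre2017, Def. 1.3] -/
theorem isEquivariantDetRepr_bot_iff : IsEquivariantDetRepr ⊥ f A ↔ IsAffineDetRepr f A := by
  refine ⟨fun h => h.1, fun h => ⟨h, fun γ hγ => ?_⟩⟩
  rw [Subgroup.mem_bot] at hγ
  subst hγ
  refine ⟨1, 1, ?_⟩
  simp [Matrix.map_one C C_0 C_1]

/-- Hence `HasEquivariantDetRepr ⊥ = HasDetRepr`. [cite: LandsbergRessayre2017, §1] -/
theorem hasEquivariantDetRepr_bot_iff : HasEquivariantDetRepr ⊥ f m ↔ HasDetRepr f m :=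
  exists_congr fun _ => isEquivariantDetRepr_bot_iff

/-- And `edc_{1}(f) = dc(f)`. [cite: LandsbergRessayre2017, §1] -/
theorem equivariantDetComplexity_bot (f : MvPolynomial σ k) :
    equivariantDetComplexity ⊥ f = determinantalComplexity f := by
  simp only [equivariantDetComplexity, determinantalComplexity, hasEquivariantDetRepr_bot_iff]

/-- `HasEquivariantDetRepr` is antitone in `Γ`. [cite: LandsbergRessayre2017, Def. 1.3] -/
theorem HasEquivariantDetRepr.anti (h : HasEquivariantDetRepr Γ f m) (hle : Γ' ≤ Γ) :
    HasEquivariantDetRepr Γ' f m :=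
  h.imp fun _ hA => hA.anti hle

/-- An equivariant representation of size `m` bounds `edc_Γ(f) ≤ m`. [cite: LandsbergRessayre2017, §1] -/
theorem equivariantDetComplexity_le (h : HasEquivariantDetRepr Γ f m) :
    equivariantDetComplexity Γ f ≤ m :=
  Nat.sInf_le h

/-- `dc(f) ≤ edc_Γ(f)` as soon as some `Γ`-equivariant representation exists (otherwise `edc` is
the junk `0`) (Landsberg–Ressayre 2017, §1). [cite: LandsbergRessayre2017, §1] -/
theorem determinantalComplexity_le_equivariantDetComplexity (h : ∃ m, HasEquivariantDetRepr Γ f m) :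
    determinantalComplexity f ≤ equivariantDetComplexity Γ f := by
  have hmem : HasEquivariantDetRepr Γ f (equivariantDetComplexity Γ f) := Nat.sInf_mem h
  exact Nat.sInf_le ((hasEquivariantDetRepr_bot_iff).1 (hmem.anti bot_le))

/-- `edc` is monotone in the symmetry group (when a `Γ`-equivariant representation exists).
[cite: LandsbergRessayre2017, §1] -/
theorem equivariantDetComplexity_mono (hle : Γ' ≤ Γ) (h : ∃ m, HasEquivariantDetRepr Γ f m) :
    equivariantDetComplexity Γ' f ≤ equivariantDetComplexity Γ f :=
  have hmem : HasEquivariantDetRepr Γ f (equivariantDetComplexity Γ f) := Nat.sInf_mem h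
  Nat.sInf_le (hmem.anti hle)

/-- Equivariance forces projective invariance: if `A(γ·x) = g A(x) h⁻¹` with `det A = f` then
`γ · f = det g · det h⁻¹ · f`; in particular `Γ` lies in the projective stabiliser of `f`
(Landsberg–Ressayre 2017, §1: `𝔾_A → 𝔾_P`). [cite: LandsbergRessayre2017, §1] -/
theorem IsEquivariantDetRepr.linSubst_eq_smul (h : IsEquivariantDetRepr Γ f A) {γ : GL σ k}
    (hγ : γ ∈ Γ) : ∃ g h' : GL (Fin m) k,
      linSubst σ k (γ : Matrix σ σ k) f =
        C ((g : Matrix (Fin m) (Fin m) k).det *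
          ((h'⁻¹ : GL (Fin m) k) : Matrix (Fin m) (Fin m) k).det) * f := by
  obtain ⟨g, h', hgh⟩ := h.2 γ hγ
  refine ⟨g, h', ?_⟩
  have hdet := congrArg Matrix.det hgh
  rw [Matrix.det_mul, Matrix.det_mul] at hdet
  have hA : (Matrix.linSubstEntries γ A).det = linSubst σ k (γ : Matrix σ σ k) A.det := by
    simp only [Matrix.linSubstEntries]
    exact (AlgHom.map_det (linSubst σ k (γ : Matrix σ σ k)) A).symm
  rw [hA, h.1.2] at hdet
  rw [hdet, map_mul, RingHom.map_det, RingHom.map_det, RingHom.mapMatrix_apply,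
    RingHom.mapMatrix_apply]
  ring

end Literature.Computability.AlgebraicComplexity

end
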